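import Literature.Computability.MetaComplexity.ListDecodableCodeAdviceDecoderFP
import Literature.Computability.MetaComplexity.GapMINKTCodeAdvice
import HarnessLib

/-!
# A polynomial-time list-decodable binary code (Hirahara 2018, Thm. 4.7), VI: the theorem in advice form, and Cor. 4.23 from `[BFP05]`

Topic `Literature/Computability/MetaComplexity`. Assembly of the vendoring of S. Hirahara,
*Non-black-box worst-case to average-case reductions within NP*, FOCS 2018 / ECCC TR18-138,
**Thm. 4.7** (`ListDecodableCode.lean`, `…Sudan.lean`, `…PolyLists.lean`, `…AdviceDecoder.lean`,
`…AdviceDecoderFP.lean`) in exactly the ADVICE FORM consumed by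
`Hirahara2018_gapMINKT_mem_PromiseP_of_adviceCode` (`GapMINKTCodeAdvice.lean`):

* `LDC.ell_le` — `ℓ(n, e) ≤ 36 (⌊log₂(n+e)⌋ + 1)`; `LDC.advOf μ β v` — the advice string
  `⟨bin μ, ⟨bin β, bin v⟩⟩`, its fields (`advFields_advOf`) and its length
  (`length_advOf_le`: `≤ 70 (⌊log₂(n+e)⌋ + 1)` for `μ < 16e³`, `β, v < q ≤ 2^b`);
* **`LDC.Hirahara2018_thm47_adviceCode`** — *there are `enc, decA ∈ FP` and constants such that
  `|Enc(1ᵉ, x)| = 2^{ℓ(|x|, e)}`, `ℓ(n,e) = O(log(n+e))`, and every word agreeing with `Enc(1ᵉ, x)`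
  on `≥ (1/2 + 1/e)·2^ℓ` positions is decoded to `x` by `decA` under some advice of length
  `O(log(n+e))`* [Hirahara2018, Thm. 4.7 with Cor. 4.8's advice reading of the list];
* **`Hirahara2018_gapMINKT_mem_PromiseP_of_BFP`** — Hirahara's Cor. 4.23
  (`Hirahara2018_gapMINKT_mem_PromiseP`) from the single remaining named fact
  `BuhrmanFortnowPavan2004_PromiseBPP'_subset_PromiseP` ([BFP05, Thm. 3.1]).

Everything is proved; no named fact is introduced.

## References

* S. Hirahara, ECCC TR18-138 (2018) / FOCS 2018, Thm. 4.7, Cor. 4.8, Cor. 4.23 [Hirahara2018].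
* H. Buhrman, L. Fortnow, A. Pavan, *Some results on derandomization*, Theory Comput. Syst. 38
  (2005), Thm. 3.1 [BuhrmanFortnowPavan2005].
* S. Arora, B. Barak, *Computational Complexity: A Modern Approach*, CUP 2009, §19.3–19.4
  [AroraBarakCC2009].
-/

noncomputable section

namespace Literature.Computability.MetaComplexity

open _root_.Computability Complexity Complexity.Brick Complexity.CodeFP

namespace LDC

/-! ### The block length is logarithmic -/

/-- `log₂ (m^5) ≤ 5 log₂ m + 4`. [folklore] -/
theorem log_pow_five_le (m : ℕ) : Nat.log 2 (m ^ 5) ≤ 5 * Nat.log 2 m + 4 := by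
  rcases Nat.eq_zero_or_pos m with rfl | hm
  · simp
  · have h1 : m < 2 ^ (Nat.log 2 m + 1) := Nat.lt_pow_succ_log_self Nat.one_lt_two m
    have h2 : m ^ 5 < 2 ^ (5 * (Nat.log 2 m + 1)) := by
      calc m ^ 5 < (2 ^ (Nat.log 2 m + 1)) ^ 5 := Nat.pow_lt_pow_left h1 (by norm_num)
        _ = 2 ^ (5 * (Nat.log 2 m + 1)) := by rw [← pow_mul, mul_comm]
    have h3 : Nat.log 2 (m ^ 5) < 5 * (Nat.log 2 m + 1) := Nat.log_lt_of_lt_pow (by positivity : 0 < m ^ 5).ne' h2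
    omega

/-- **`ℓ(n, e) ≤ 36 (⌊log₂(n+e)⌋ + 1)`.** [cite: Hirahara2018, Thm. 4.7 (`ℓ = O(log(n/ε))`)] -/
theorem ell_le (n e : ℕ) : ell n e ≤ 36 * (Nat.log 2 (n + e) + 1) := by
  rw [ell, bOf]
  rcases Nat.eq_zero_or_pos e with rfl | he
  · simp only [zero_pow (by norm_num : 4 ≠ 0), zero_mul, Nat.log_zero_right]; omega
  · have h1 : e ^ 4 * (n + 1) ≤ (n + e) ^ 5 := by
      calc e ^ 4 * (n + 1) ≤ (n + e) ^ 4 * (n + e) := Nat.mul_le_mul (Nat.pow_le_pow_left (by omega) 4) (by omega)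
        _ = (n + e) ^ 5 := by ring
    have h2 : Nat.log 2 (e ^ 4 * (n + 1)) ≤ 5 * Nat.log 2 (n + e) + 4 := (Nat.log_mono_right h1).trans (log_pow_five_le _)
    omega

/-! ### The advice string -/

/-- **The advice `⟨bin μ, ⟨bin β, bin v⟩⟩`.** [cite: Hirahara2018, Cor. 4.8 (the `O(log(n/ε))` bits of advice)] -/
def advOf (μ β v : ℕ) : List Bool := boolPair (natE μ) (boolPair (natE β) (natE v))

/-- The decoder reads back `(μ, β, v)`. [folklore] -/
theorem advFields_advOf (μ β v : ℕ) : advFields (advOf μ β v) = (μ, β, v) := by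
  simp [advFields, advOf, fstF_boolPair, sndF_boolPair, natE]

/-- **The advice is short**: for `μ < 16e³` and `β, v < 2^b` (`b = bOf n e`, `e ≥ 1`),
`|advOf μ β v| ≤ 70 (⌊log₂(n+e)⌋ + 1)`. [cite: Hirahara2018, Cor. 4.8] -/
theorem length_advOf_le {n e μ β v : ℕ} (he : 1 ≤ e) (hμ : μ < JOf e) (hβ : β < 2 ^ bOf n e) (hv : v < 2 ^ bOf n e) :
    (advOf μ β v).length ≤ 70 * (Nat.log 2 (n + e) + 1) := by
  have hb : bOf n e ≤ 5 * Nat.log 2 (n + e) + 17 := by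
    have h1 : e ^ 4 * (n + 1) ≤ (n + e) ^ 5 := by
      calc e ^ 4 * (n + 1) ≤ (n + e) ^ 4 * (n + e) := Nat.mul_le_mul (Nat.pow_le_pow_left (by omega) 4) (by omega)
        _ = (n + e) ^ 5 := by ring
    have h2 : Nat.log 2 (e ^ 4 * (n + 1)) ≤ 5 * Nat.log 2 (n + e) + 4 := (Nat.log_mono_right h1).trans (log_pow_five_le _)
    rw [bOf]; omega
  -- `μ < 16 e³ ≤ 2^{3 log₂(n+e) + 7}`
  have hμ' : Nat.size μ ≤ 3 * Nat.log 2 (n + e) + 7 := by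
    refine Nat.size_le.2 (hμ.trans_le ?_)
    have h1 : e < 2 ^ (Nat.log 2 (n + e) + 1) := lt_of_le_of_lt (by omega) (Nat.lt_pow_succ_log_self Nat.one_lt_two (n + e))
    rw [JOf]
    calc 16 * e ^ 3 ≤ 16 * (2 ^ (Nat.log 2 (n + e) + 1)) ^ 3 := Nat.mul_le_mul_left _ (Nat.pow_le_pow_left h1.le 3)
      _ = 2 ^ (3 * Nat.log 2 (n + e) + 7) := by rw [← pow_mul]; ring
  have hβ' : Nat.size β ≤ bOf n e := Nat.size_le.2 hβ
  have hv' : Nat.size v ≤ bOf n e := Nat.size_le.2 hv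
  simp only [advOf, length_boolPair, length_natE]
  omega

/-! ### Thm. 4.7 in advice form -/

/-- **Hirahara 2018, Thm. 4.7 (with the advice reading of Cor. 4.8): a polynomial-time binary code of
block length `2^{O(log(n/ε))}` whose every `(1/2 + ε)`-close word is decoded to the message in
polynomial time under `O(log(n/ε))` bits of advice** — in exactly the shape `hcodeA` of
`Hirahara2018_gapMINKT_mem_PromiseP_of_adviceCode` (`ε = 1/e`, constants `c_L = 36`, `c_A = 70`).
[cite: Hirahara2018, Thm. 4.7, Cor. 4.8] [cite: AroraBarakCC2009, §19.3–19.4] -/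
theorem Hirahara2018_thm47_adviceCode :
    ∃ (enc decA : List Bool → List Bool) (ell : ℕ → ℕ → ℕ) (cL cA : ℕ),
      enc ∈ FP ∧ decA ∈ FP ∧ (∀ n e, ell n e ≤ cL * (Nat.log 2 (n + e) + 1)) ∧
      (∀ (n e : ℕ) (x : List Bool), x.length = n → (enc (boolPair (ones e) x)).length = 2 ^ ell n e) ∧
      (∀ (n e : ℕ) (x r : List Bool), x.length = n → 1 ≤ e → r.length = 2 ^ ell n e →
        (e + 2) * 2 ^ ell n e ≤ 2 * e * NWStr.agreeCount r (enc (boolPair (ones e) x)) →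
        ∃ adv : List Bool, adv.length ≤ cA * (Nat.log 2 (n + e) + 1) ∧
          decA (boolPair adv (boolPair (ones e) (boolPair (ones n) r))) = x) := by
  obtain ⟨encF, hencF, henc⟩ := exists_encFn
  obtain ⟨decF, hdecF, hdec⟩ := exists_decFn
  refine ⟨encF, decF, ell, 36, 70, hencF, hdecF, ell_le, fun n e x hx => ?_, fun n e x r hx he hr hagree => ?_⟩
  · rw [henc, length_enc, hx]
  · rw [henc] at hagree
    obtain ⟨μ, β, v, hμ, hβ, hv, hdecode⟩ := exists_advice_decodeL hx he hr hagree
    have hβB := hβ.trans_le (qOf_le_two_pow n e)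
    have hvB := hv.trans_le (qOf_le_two_pow n e)
    refine ⟨advOf μ β v, length_advOf_le he hμ hβB hvB, ?_⟩
    rw [hdec, advFields_advOf]
    have hcap : min μ (capOf n e) = μ :=
      min_eq_left (hμ.le.trans ((JOf_le n e).trans (base_pow_mono n e (by norm_num))))
    simpa only [hcap] using hdecode

end LDC

/-- **Hirahara 2018, Cor. 4.23 from `[BFP05, Thm. 3.1]` alone**: if `DistNP ⊆ AvgP` then
`Gap(σ,τ)MINKT ∈ PromiseP`, given `BuhrmanFortnowPavan2004_PromiseBPP'_subset_PromiseP` — the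
list-decodable code of Thm. 4.7 being now vendored and proved (`LDC.Hirahara2018_thm47_adviceCode`).
[cite: Hirahara2018, Cor. 4.23 (proof), Thm. 4.7] -/
theorem Hirahara2018_gapMINKT_mem_PromiseP_of_BFP (hBPP : BuhrmanFortnowPavan2004_PromiseBPP'_subset_PromiseP) :
    Hirahara2018_gapMINKT_mem_PromiseP :=
  Hirahara2018_gapMINKT_mem_PromiseP_of_adviceCode hBPP LDC.Hirahara2018_thm47_adviceCode

end Literature.Computability.MetaComplexity

end
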